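import Summits.CriticalPhenomena.PercolationContinuityZ3.Theorems.PercNearOneGluingNoHeavyLowerTailThreePointPiecesClasses
import Summits.CriticalPhenomena.PercolationContinuityZ3.Theorems.PercNearOneGluingNoHeavyLowerTailSuperTerminalQuarticHubProb
import HarnessLib

/-!
# The piece calculus for TWO-HUB pieces: cylinder isolation probabilities of a piece with two inner vertices
# (Sahi programme, prover prim-sahi-p2 gen 46)

Support file (`--supports stmt-CriticalPhenomena-4575`, helper), extending prim-l12-p1's three-terminal piece calculus
(`…ThreePointPieces`, `…ThreePointPiecesClasses`: `pieceConn`, `isoPiece`, `isoPiece_hub_eq`) from single-hub pieces to pieces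
with exactly two non-terminal vertices `h₁, h₂` (pairs `h₁h₂` and `hⱼ–terminal`; the "`K₅` piece").  No definitions, no named facts,
no sorries; standard axioms.  Memo `run/shared/lean/prim/prim-sahi/FROM-prim-sahi-p2-gen46-*.md`.

* `isoPiece_twoHub_iff` [this work] — inside such a piece, terminal `x` is separated from the other two terminals `y, z` iff NOT
  [`x–h₁` open and `h₁` touches `{y,z}`] ∨ [`x–h₂` open and `h₂` touches `{y,z}`] ∨ [`h₁h₂` open, `x` touches `{h₁,h₂}`, and `{h₁,h₂}`
  touches `{y,z}`] (closure of an explicit reach set under piece adjacency; detours through the third terminal never matter for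
  isolation events).
* `real_mergedIso`, `real_mergedBoth` [this work] — probabilities of the MERGED-HUB events (the hub pair `{h₁, h₂}` acting as one hub
  with `∨`-weights `1 − (1−u₁)(1−u₂)`): `μ(¬[(xh₁ ∨ xh₂) ∧ (yh₁ ∨ zh₁ ∨ yh₂ ∨ zh₂)])` and `μ((xh₁ ∨ xh₂) ∧ (yh₁ ∨ yh₂))` as products
  (independence over disjoint pair sets, `prodBernoulli_real_inter_of_determinedBy_disjoint`).
Part II (`…ThreePointPiecesTwoHubsCoords`) conditions on the interior pair and computes the cylinder isolation coordinates of the piece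
as `λ·(merged hub) + (1−λ)·(hub₁ ⊙ hub₂)`; `…ThreePointHalvingSmallPieces` then assembles the halving lemma (v) for graphs whose pieces
have at most two inner vertices (with `HalvingTwoHub.twoHubPair_halving`).
-/

namespace Summit.CriticalPhenomena.PercolationContinuityZ3.Theorems.ThreePointPiecesTwoHub

open MeasureTheory Set
open Literature.Probability.Percolation Literature.Probability.LatticeModels
open Summit.CriticalPhenomena.PercolationContinuityZ3.Theorems.ThreePointPieces
open Summit.CriticalPhenomena.PercolationContinuityZ3.Theorems.ThreePointHubEvents (isoH determinedBy_of_iff determinedBy_isoH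
  real_isoH real_sepH)

variable {V : Type*} [Fintype V] [DecidableEq V] {ι : Type*} [DecidableEq ι]

/-! ## Reachability inside a two-hub piece -/

section conn
variable {a b c : V} {part : V → ι} {i : ι} {h₁ h₂ : V}


/-- A star pair `s(p, hⱼ)` of the piece is a piece pair. [this work] -/
theorem starPair_mem {p h : V} (hh : h ∉ terms a b c) (hhi : part h = i) (hp : p ∈ terms a b c) :
    s(p, h) ∈ piecePairs a b c part i := by
  rw [Sym2.eq_swap]; exact mk_mem_piecePairs hh hhi (Or.inr hp) (fun e => hh (e ▸ hp))


/-- The interior pair `s(h₁, h₂)` is a piece pair. [this work] -/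
theorem innerPair_mem (h12 : h₁ ≠ h₂) (hh₁ : h₁ ∉ terms a b c) (hh₂ : h₂ ∉ terms a b c) (hi₁ : part h₁ = i) (hi₂ : part h₂ = i) :
    s(h₁, h₂) ∈ piecePairs a b c part i :=
  mk_mem_piecePairs hh₁ hi₁ (Or.inl ⟨hh₂, hi₂⟩) h12


/-- An open piece pair is an edge of the piece graph. [this work] -/
theorem adj_of_mem {ω : BondConfig V} {p q : V} (hω : s(p, q) ∈ ω) (hF : s(p, q) ∈ piecePairs a b c part i) (hpq : p ≠ q) :
    (openGraph (ω ∩ ↑(piecePairs a b c part i))).Adj p q :=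
  (openGraph_adj _ _ _).2 ⟨⟨hω, Finset.mem_coe.2 hF⟩, hpq⟩


/-- **Isolation inside a two-hub piece.**  If the non-terminals of piece `i` are exactly `h₁ ≠ h₂` and the terminals are `x, y, z`
(`x ≠ y, z`), then `x` is separated from `y` and `z` inside the piece iff none of: `x–h₁` open with `h₁` joined to `y` or `z`;
`x–h₂` open with `h₂` joined to `y` or `z`; `h₁h₂` open with `x` joined to a hub and a hub joined to `y` or `z`. [this work] -/
theorem isoPiece_twoHub_iff (h12 : h₁ ≠ h₂) (hh₁ : h₁ ∉ terms a b c) (hh₂ : h₂ ∉ terms a b c) (hi₁ : part h₁ = i) (hi₂ : part h₂ = i)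
    (hi : ∀ v, v ∉ terms a b c → part v = i → v = h₁ ∨ v = h₂) {x y z : V} (hT : ∀ v, v ∈ terms a b c → v = x ∨ v = y ∨ v = z)
    (hx : x ∈ terms a b c) (hy : y ∈ terms a b c) (hz : z ∈ terms a b c) (hxy : x ≠ y) (hxz : x ≠ z) {ω : BondConfig V} :
    ω ∈ isoPiece (piecePairs a b c part i) x y z ↔
      ¬ ((s(x, h₁) ∈ ω ∧ (s(y, h₁) ∈ ω ∨ s(z, h₁) ∈ ω)) ∨ (s(x, h₂) ∈ ω ∧ (s(y, h₂) ∈ ω ∨ s(z, h₂) ∈ ω)) ∨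
        (s(h₁, h₂) ∈ ω ∧ (s(x, h₁) ∈ ω ∨ s(x, h₂) ∈ ω) ∧ (s(y, h₁) ∈ ω ∨ s(z, h₁) ∈ ω ∨ s(y, h₂) ∈ ω ∨ s(z, h₂) ∈ ω))) := by
  set F := piecePairs a b c part i with hF
  have hx1 : h₁ ≠ x := fun e => hh₁ (e ▸ hx)
  have hx2 : h₂ ≠ x := fun e => hh₂ (e ▸ hx)
  have hy1 : h₁ ≠ y := fun e => hh₁ (e ▸ hy)
  have hy2 : h₂ ≠ y := fun e => hh₂ (e ▸ hy)
  have hz1 : h₁ ≠ z := fun e => hh₁ (e ▸ hz)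
  have hz2 : h₂ ≠ z := fun e => hh₂ (e ▸ hz)
  -- adjacency facts
  have A : ∀ {p h : V}, h ∉ terms a b c → part h = i → p ∈ terms a b c → h ≠ p → s(p, h) ∈ ω →
      (openGraph (ω ∩ ↑F)).Reachable p h := fun hh hhi hp hne hω =>
    (adj_of_mem hω (starPair_mem hh hhi hp) (Ne.symm hne)).reachable
  have AL : s(h₁, h₂) ∈ ω → (openGraph (ω ∩ ↑F)).Reachable h₁ h₂ := fun hω =>
    (adj_of_mem hω (innerPair_mem h12 hh₁ hh₂ hi₁ hi₂) h12).reachable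
  constructor
  · rintro ⟨hny, hnz⟩ hd
    simp only [pieceConn, mem_compl_iff, mem_setOf_eq] at hny hnz
    -- `x` reaches a hub `h` which touches `y` or `z`: contradiction
    have touch : ∀ {h : V}, h ∉ terms a b c → part h = i → (openGraph (ω ∩ ↑F)).Reachable x h →
        ¬ (s(y, h) ∈ ω ∨ s(z, h) ∈ ω) := by
      intro h hh hhi hr ht
      rcases ht with hyh | hzh
      · exact hny (hr.trans (A hh hhi hy (fun e => hh (e ▸ hy)) hyh).symm)
      · exact hnz (hr.trans (A hh hhi hz (fun e => hh (e ▸ hz)) hzh).symm)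
    rcases hd with ⟨hx₁, ht⟩ | ⟨hx₂, ht⟩ | ⟨hL, hxh, ht⟩
    · exact touch hh₁ hi₁ (A hh₁ hi₁ hx hx1 hx₁) ht
    · exact touch hh₂ hi₂ (A hh₂ hi₂ hx hx2 hx₂) ht
    · have r1 : (openGraph (ω ∩ ↑F)).Reachable x h₁ := by
        rcases hxh with hx₁ | hx₂
        · exact A hh₁ hi₁ hx hx1 hx₁
        · exact (A hh₂ hi₂ hx hx2 hx₂).trans (AL hL).symm
      have r2 : (openGraph (ω ∩ ↑F)).Reachable x h₂ := r1.trans (AL hL)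
      rcases ht with h | h | h | h
      · exact touch hh₁ hi₁ r1 (Or.inl h)
      · exact touch hh₁ hi₁ r1 (Or.inr h)
      · exact touch hh₂ hi₂ r2 (Or.inl h)
      · exact touch hh₂ hi₂ r2 (Or.inr h)
  · intro hnd
    -- the reach set `R = {x} ∪ {h₁ if reached} ∪ {h₂ if reached}` is closed under piece adjacency
    set r₁ : Prop := s(x, h₁) ∈ ω ∨ (s(x, h₂) ∈ ω ∧ s(h₁, h₂) ∈ ω) with hr₁
    set r₂ : Prop := s(x, h₂) ∈ ω ∨ (s(x, h₁) ∈ ω ∧ s(h₁, h₂) ∈ ω) with hr₂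
    set R : Set V := {v | v = x ∨ (v = h₁ ∧ r₁) ∨ (v = h₂ ∧ r₂)} with hR
    have hcl : ∀ u v, (openGraph (ω ∩ ↑F)).Adj u v → u ∈ R → v ∈ R := by
      intro u v huv hu
      rw [openGraph_adj] at huv
      obtain ⟨⟨he, heF⟩, hne⟩ := huv
      obtain ⟨hu1, hv1, huv1⟩ := mem_piecePairs_mk (Finset.mem_coe.1 heF)
      rcases hu with rfl | ⟨rfl, hr⟩ | ⟨rfl, hr⟩
      · -- `u = x` (a terminal): `v` is a hub
        have hv' : v ∉ terms a b c ∧ part v = i := by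
          rcases huv1 with h | h
          · exact (h.1 hx).elim
          · exact h
        rcases hi v hv'.1 hv'.2 with rfl | rfl
        · exact Or.inr (Or.inl ⟨rfl, Or.inl he⟩)
        · exact Or.inr (Or.inr ⟨rfl, Or.inl he⟩)
      · -- `u = h₁`, reached
        rcases hv1 with ⟨hvT, hvi⟩ | hvT
        · rcases hi v hvT hvi with rfl | rfl
          · exact (hne rfl).elim
          · refine Or.inr (Or.inr ⟨rfl, ?_⟩)
            rcases hr with h | ⟨h, -⟩
            · exact Or.inr ⟨h, he⟩
            · exact Or.inl h
        · rcases hT v hvT with rfl | rfl | rfl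
          · exact Or.inl rfl
          · exfalso; apply hnd
            have hyv : s(v, u) ∈ ω := by rw [Sym2.eq_swap]; exact he
            rcases hr with h | ⟨h, hL⟩
            · exact Or.inl ⟨h, Or.inl hyv⟩
            · exact Or.inr (Or.inr ⟨hL, Or.inr h, Or.inl hyv⟩)
          · exfalso; apply hnd
            have hzv : s(v, u) ∈ ω := by rw [Sym2.eq_swap]; exact he
            rcases hr with h | ⟨h, hL⟩
            · exact Or.inl ⟨h, Or.inr hzv⟩
            · exact Or.inr (Or.inr ⟨hL, Or.inr h, Or.inr (Or.inl hzv)⟩)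
      · -- `u = h₂`, reached
        rcases hv1 with ⟨hvT, hvi⟩ | hvT
        · rcases hi v hvT hvi with rfl | rfl
          · refine Or.inr (Or.inl ⟨rfl, ?_⟩)
            have hL : s(v, u) ∈ ω := by rw [Sym2.eq_swap]; exact he
            rcases hr with h | ⟨h, -⟩
            · exact Or.inr ⟨h, hL⟩
            · exact Or.inl h
          · exact (hne rfl).elim
        · rcases hT v hvT with rfl | rfl | rfl
          · exact Or.inl rfl
          · exfalso; apply hnd
            have hyv : s(v, u) ∈ ω := by rw [Sym2.eq_swap]; exact he
            rcases hr with h | ⟨h, hL⟩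
            · exact Or.inr (Or.inl ⟨h, Or.inl hyv⟩)
            · exact Or.inr (Or.inr ⟨hL, Or.inl h, Or.inr (Or.inr (Or.inl hyv))⟩)
          · exfalso; apply hnd
            have hzv : s(v, u) ∈ ω := by rw [Sym2.eq_swap]; exact he
            rcases hr with h | ⟨h, hL⟩
            · exact Or.inr (Or.inl ⟨h, Or.inr hzv⟩)
            · exact Or.inr (Or.inr ⟨hL, Or.inl h, Or.inr (Or.inr (Or.inr hzv))⟩)
    have hstay : ∀ {u v : V} (_ : (openGraph (ω ∩ ↑F)).Walk u v), u ∈ R → v ∈ R := by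
      intro u v q
      induction q with
      | nil => exact id
      | cons h' _ ih => exact fun hu => ih (hcl _ _ h' hu)
    have notR : ∀ {t : V}, t ∈ terms a b c → t ≠ x → t ∉ R := by
      intro t ht htx hmem
      rcases hmem with h | ⟨h, -⟩ | ⟨h, -⟩
      · exact htx h
      · exact hh₁ (h ▸ ht)
      · exact hh₂ (h ▸ ht)
    refine ⟨fun ⟨p⟩ => notR hy (Ne.symm hxy) (hstay p (Or.inl rfl)), fun ⟨p⟩ => notR hz (Ne.symm hxz) (hstay p (Or.inl rfl))⟩

end conn

/-! ## Probabilities of the merged-hub events -/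

section prob
variable (w : Sym2 V → unitInterval)

omit [Fintype V] [DecidableEq V] in
/-- Two pairs through different hubs differ as soon as the second hub is not the first pair's terminal. [folklore] -/
theorem hubPair_ne {p q h₁ h₂ : V} (h12 : h₁ ≠ h₂) (h2p : h₂ ≠ p) : s(p, h₁) ≠ s(q, h₂) := by
  intro e
  rcases Sym2.eq_iff.1 e with ⟨-, e2⟩ | ⟨e1, -⟩
  · exact h12 e2
  · exact h2p e1.symm

/-- `μ(e₁ open ∨ e₂ open) = 1 − (1 − w e₁)(1 − w e₂)` for distinct pairs. [folklore] -/
theorem real_or_pair {e₁ e₂ : Sym2 V} (hne : e₁ ≠ e₂) :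
    (prodBernoulli w).real {ω : BondConfig V | e₁ ∈ ω ∨ e₂ ∈ ω} = 1 - (1 - (w e₁ : ℝ)) * (1 - (w e₂ : ℝ)) := by
  have hset : {ω : BondConfig V | e₁ ∈ ω ∨ e₂ ∈ ω} = {ω : BondConfig V | ∀ e ∈ ({e₁, e₂} : Finset (Sym2 V)), e ∉ ω}ᶜ := by
    ext ω; simp only [mem_setOf_eq, mem_compl_iff, Finset.mem_insert, Finset.mem_singleton, forall_eq_or_imp, forall_eq]; tauto
  rw [hset, probReal_compl_eq_one_sub MeasurableSet.of_discrete, prodBernoulli_real_forall_notMem, Finset.prod_pair hne]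

omit [Fintype V] in
/-- `μ(e₁, e₂ both closed) = (1 − w e₁)(1 − w e₂)` for distinct pairs. [folklore] -/
theorem real_closed_pair {e₁ e₂ : Sym2 V} (hne : e₁ ≠ e₂) :
    (prodBernoulli w).real {ω : BondConfig V | e₁ ∉ ω ∧ e₂ ∉ ω} = (1 - (w e₁ : ℝ)) * (1 - (w e₂ : ℝ)) := by
  have hset : {ω : BondConfig V | e₁ ∉ ω ∧ e₂ ∉ ω} = {ω : BondConfig V | ∀ e ∈ ({e₁, e₂} : Finset (Sym2 V)), e ∉ ω} := by
    ext ω; simp only [mem_setOf_eq, Finset.mem_insert, Finset.mem_singleton, forall_eq_or_imp, forall_eq]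
  rw [hset, prodBernoulli_real_forall_notMem, Finset.prod_pair hne]

omit [Fintype V] in
/-- A two-pair disjunction event is determined by the two pairs. [folklore] -/
theorem determinedBy_or_pair (e₁ e₂ : Sym2 V) :
    DeterminedBy {ω : BondConfig V | e₁ ∈ ω ∨ e₂ ∈ ω} (↑({e₁, e₂} : Finset (Sym2 V)) : Set (Sym2 V)) :=
  determinedBy_of_iff fun ω ω' hF => by
    simp only [mem_setOf_eq, hF _ (by simp : e₁ ∈ ({e₁, e₂} : Finset (Sym2 V))), hF _ (by simp : e₂ ∈ ({e₁, e₂} : Finset (Sym2 V)))]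

omit [Fintype V] in
/-- A two-pair conjunction-of-closures event is determined by the two pairs. [folklore] -/
theorem determinedBy_closed_pair (e₁ e₂ : Sym2 V) :
    DeterminedBy {ω : BondConfig V | e₁ ∉ ω ∧ e₂ ∉ ω} (↑({e₁, e₂} : Finset (Sym2 V)) : Set (Sym2 V)) :=
  determinedBy_of_iff fun ω ω' hF => by
    simp only [mem_setOf_eq, hF _ (by simp : e₁ ∈ ({e₁, e₂} : Finset (Sym2 V))), hF _ (by simp : e₂ ∈ ({e₁, e₂} : Finset (Sym2 V)))]

variable {x y z h₁ h₂ : V}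

/-- **Merged-hub isolation probability.**  For distinct `x, y, z`, hubs `h₁ ≠ h₂` off the terminals:
`μ(¬[(xh₁ ∨ xh₂ open) ∧ (one of yh₁, zh₁, yh₂, zh₂ open)]) = 1 − (1 − (1−x₁)(1−x₂))·(1 − (1−y₁)(1−z₁)(1−y₂)(1−z₂))`. [this work] -/
theorem real_mergedIso (hxy : x ≠ y) (hxz : x ≠ z) (hyz : y ≠ z) (h12 : h₁ ≠ h₂) (h1x : h₁ ≠ x) (h2x : h₂ ≠ x) (h2y : h₂ ≠ y)
    (h2z : h₂ ≠ z) :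
    (prodBernoulli w).real {ω : BondConfig V | ¬ ((s(x, h₁) ∈ ω ∨ s(x, h₂) ∈ ω) ∧
        (s(y, h₁) ∈ ω ∨ s(z, h₁) ∈ ω ∨ s(y, h₂) ∈ ω ∨ s(z, h₂) ∈ ω))} =
      1 - (1 - (1 - (w s(x, h₁) : ℝ)) * (1 - (w s(x, h₂) : ℝ))) *
        (1 - (1 - (w s(y, h₁) : ℝ)) * (1 - (w s(z, h₁) : ℝ)) * ((1 - (w s(y, h₂) : ℝ)) * (1 - (w s(z, h₂) : ℝ)))) := by
  set XX : Set (BondConfig V) := {ω | s(x, h₁) ∈ ω ∨ s(x, h₂) ∈ ω} with hXX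
  set C1 : Set (BondConfig V) := {ω | s(y, h₁) ∉ ω ∧ s(z, h₁) ∉ ω} with hC1
  set C2 : Set (BondConfig V) := {ω | s(y, h₂) ∉ ω ∧ s(z, h₂) ∉ ω} with hC2
  have hset : {ω : BondConfig V | ¬ ((s(x, h₁) ∈ ω ∨ s(x, h₂) ∈ ω) ∧
      (s(y, h₁) ∈ ω ∨ s(z, h₁) ∈ ω ∨ s(y, h₂) ∈ ω ∨ s(z, h₂) ∈ ω))} = (XX ∩ (C1 ∩ C2)ᶜ)ᶜ := by
    ext ω; simp only [hXX, hC1, hC2, mem_setOf_eq, mem_compl_iff, mem_inter_iff]; tauto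
  have hXXd : DeterminedBy XX (↑({s(x, h₁), s(x, h₂)} : Finset (Sym2 V)) : Set (Sym2 V)) := determinedBy_or_pair _ _
  have hC1d : DeterminedBy C1 (↑({s(y, h₁), s(z, h₁)} : Finset (Sym2 V)) : Set (Sym2 V)) := determinedBy_closed_pair _ _
  have hC2d : DeterminedBy C2 (↑({s(y, h₂), s(z, h₂)} : Finset (Sym2 V)) : Set (Sym2 V)) := determinedBy_closed_pair _ _
  have hC12d : DeterminedBy (C1 ∩ C2)ᶜ (↑({s(y, h₁), s(z, h₁)} ∪ {s(y, h₂), s(z, h₂)} : Finset (Sym2 V)) : Set (Sym2 V)) := by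
    rw [Finset.coe_union]
    exact OneLayerTwoFinger.determinedBy_compl ((hC1d.mono subset_union_left).inter (hC2d.mono subset_union_right))
  have hdisjX : Disjoint ({s(x, h₁), s(x, h₂)} : Finset (Sym2 V)) ({s(y, h₁), s(z, h₁)} ∪ {s(y, h₂), s(z, h₂)}) := by
    simp only [Finset.disjoint_left, Finset.mem_insert, Finset.mem_singleton, Finset.mem_union]
    rintro e (rfl | rfl)
    · rintro ((e | e) | (e | e))
      · exact SuperTerminalQuarticHubProb.spair_ne hxy e
      · exact SuperTerminalQuarticHubProb.spair_ne hxz e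
      · exact hubPair_ne h12 h2x e
      · exact hubPair_ne h12 h2x e
    · rintro ((e | e) | (e | e))
      · exact hubPair_ne h12.symm h1x e
      · exact hubPair_ne h12.symm h1x e
      · exact SuperTerminalQuarticHubProb.spair_ne hxy e
      · exact SuperTerminalQuarticHubProb.spair_ne hxz e
  have hdisj12 : Disjoint ({s(y, h₁), s(z, h₁)} : Finset (Sym2 V)) {s(y, h₂), s(z, h₂)} := by
    simp only [Finset.disjoint_left, Finset.mem_insert, Finset.mem_singleton]
    rintro e (rfl | rfl) (e | e)
    · exact hubPair_ne h12 h2y e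
    · exact hubPair_ne h12 h2y e
    · exact hubPair_ne h12 h2z e
    · exact hubPair_ne h12 h2z e
  have rXX : (prodBernoulli w).real XX = 1 - (1 - (w s(x, h₁) : ℝ)) * (1 - (w s(x, h₂) : ℝ)) :=
    real_or_pair w (hubPair_ne h12 h2x)
  have rC1 : (prodBernoulli w).real C1 = (1 - (w s(y, h₁) : ℝ)) * (1 - (w s(z, h₁) : ℝ)) := real_closed_pair w (SuperTerminalQuarticHubProb.spair_ne hyz)
  have rC2 : (prodBernoulli w).real C2 = (1 - (w s(y, h₂) : ℝ)) * (1 - (w s(z, h₂) : ℝ)) := real_closed_pair w (SuperTerminalQuarticHubProb.spair_ne hyz)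
  have rC12 : (prodBernoulli w).real (C1 ∩ C2) = (prodBernoulli w).real C1 * (prodBernoulli w).real C2 :=
    prodBernoulli_real_inter_of_determinedBy_disjoint w hdisj12 hC1d hC2d MeasurableSet.of_discrete MeasurableSet.of_discrete
  have rI : (prodBernoulli w).real (XX ∩ (C1 ∩ C2)ᶜ) = (prodBernoulli w).real XX * (prodBernoulli w).real (C1 ∩ C2)ᶜ :=
    prodBernoulli_real_inter_of_determinedBy_disjoint w hdisjX hXXd hC12d MeasurableSet.of_discrete MeasurableSet.of_discrete
  rw [hset, probReal_compl_eq_one_sub MeasurableSet.of_discrete, rI, probReal_compl_eq_one_sub MeasurableSet.of_discrete, rC12,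
    rXX, rC1, rC2]

/-- `μ((xh₁ ∨ xh₂ open) ∧ (yh₁ ∨ yh₂ open)) = (1 − (1−x₁)(1−x₂))(1 − (1−y₁)(1−y₂))`. [this work] -/
theorem real_mergedBoth (hxy : x ≠ y) (h12 : h₁ ≠ h₂) (h1x : h₁ ≠ x) (h2x : h₂ ≠ x) (h2y : h₂ ≠ y) :
    (prodBernoulli w).real {ω : BondConfig V | (s(x, h₁) ∈ ω ∨ s(x, h₂) ∈ ω) ∧ (s(y, h₁) ∈ ω ∨ s(y, h₂) ∈ ω)} =
      (1 - (1 - (w s(x, h₁) : ℝ)) * (1 - (w s(x, h₂) : ℝ))) * (1 - (1 - (w s(y, h₁) : ℝ)) * (1 - (w s(y, h₂) : ℝ))) := by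
  have hset : {ω : BondConfig V | (s(x, h₁) ∈ ω ∨ s(x, h₂) ∈ ω) ∧ (s(y, h₁) ∈ ω ∨ s(y, h₂) ∈ ω)} =
      {ω : BondConfig V | s(x, h₁) ∈ ω ∨ s(x, h₂) ∈ ω} ∩ {ω : BondConfig V | s(y, h₁) ∈ ω ∨ s(y, h₂) ∈ ω} := by
    ext ω; simp only [mem_setOf_eq, mem_inter_iff]
  have hdisj : Disjoint ({s(x, h₁), s(x, h₂)} : Finset (Sym2 V)) {s(y, h₁), s(y, h₂)} := by
    simp only [Finset.disjoint_left, Finset.mem_insert, Finset.mem_singleton]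
    rintro e (rfl | rfl) (e | e)
    · exact SuperTerminalQuarticHubProb.spair_ne hxy e
    · exact hubPair_ne h12 h2x e
    · exact hubPair_ne h12.symm h1x e
    · exact SuperTerminalQuarticHubProb.spair_ne hxy e
  rw [hset, prodBernoulli_real_inter_of_determinedBy_disjoint w hdisj (determinedBy_or_pair _ _) (determinedBy_or_pair _ _)
    MeasurableSet.of_discrete MeasurableSet.of_discrete, real_or_pair w (hubPair_ne h12 h2x), real_or_pair w (hubPair_ne h12 h2y)]

end prob

end Summit.CriticalPhenomena.PercolationContinuityZ3.Theorems.ThreePointPiecesTwoHub
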